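import Mathlib
import Summits.Ventures.PercRepro2.ThreeTermPinnedPart
import Summits.Ventures.PercRepro2.ThreeTermUpsetPairs

/-!
# Three-terminal parts, VI f: typed edges between the terminals act like the virtual edges
(blind cell PercRepro2, night-3 g31, 2026-08-30; `proofs/NIGHT3-CERT.md` §40.10)

Preparation for (2′TRI-PINPART⁺) (ThreeTermPinnedPlus.lean): a finset `F` of edges each joining two
distinct terminals (`TermEdges`), the COMBINED PATTERN `patX x` of a configuration (bit `ab` set when some
edge of `S ∪ F` open in `x` joins `t_a` and `t_b`: `pairBit`), and

* **`conn_terminal_edges_iff`**: in the part graph, `x` has the connectivity of the virtual triangle at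
  the pattern `patX x` over the background `bg S F x` (`S ∪ F` closed) — the closure argument in both
  directions (an open terminal edge and the virtual edge of its pair join the same two terminals);
* **`stAbs_rep8`**: the abstract states of ThreeTermPinnedAbstract.lean depend on the pattern only
  through its representative (`prelB` is the same at `3, 5, 6, 7`).

Own work; standard axioms.
-/

namespace Summit.Ventures.PercRepro2

open Block ThreeTerm TypedStar CovForm CovForm.OneTyped

namespace Part

/-! ## The abstract states are constant on the fibres of the representative map -/

section Rep

/-- `prelB` at pattern `3` is `prelB` at pattern `7`. -/
lemma prelB_3 (f : Fin 6 → Fin 8) : ∀ a b, prelB f 3 a b = prelB f 7 a b := by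
  intro a b; fin_cases a <;> fin_cases b <;> simp [prelB, pstepB, pbit, bit]

/-- `prelB` at pattern `5` is `prelB` at pattern `7`. -/
lemma prelB_5 (f : Fin 6 → Fin 8) : ∀ a b, prelB f 5 a b = prelB f 7 a b := by
  intro a b; fin_cases a <;> fin_cases b <;> simp [prelB, pstepB, pbit, bit]

/-- `prelB` at pattern `6` is `prelB` at pattern `7`. -/
lemma prelB_6 (f : Fin 6 → Fin 8) : ∀ a b, prelB f 6 a b = prelB f 7 a b := by
  intro a b; fin_cases a <;> fin_cases b <;> simp [prelB, pstepB, pbit, bit]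

/-- **The abstract state depends on the pattern only through its representative.** -/
lemma stAbs_rep8 (f : Fin 6 → Fin 8) (i : Fin 8) : stAbs f i = stAbs f (rep8 i) := by
  fin_cases i
  · rfl
  · rfl
  · rfl
  · show stAbs f 3 = stAbs f 7
    simp only [stAbs, qFailB, reachB, prelB_3]
  · rfl
  · show stAbs f 5 = stAbs f 7
    simp only [stAbs, qFailB, reachB, prelB_5]
  · show stAbs f 6 = stAbs f 7
    simp only [stAbs, qFailB, reachB, prelB_6]
  · rfl

end Rep

/-! ## Terminal edges act like the virtual edges -/

section TermEdges

open Classical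

variable {V : Type*} {E : Type*} [DecidableEq E]

/-- A finset of edges each joining two distinct terminals. -/
def TermEdges (ends : E → Sym2 V) (t₁ t₂ t₃ : V) (F : Finset E) : Prop :=
  ∀ e ∈ F, ∃ a b : Fin 3, a ≠ b ∧ ends e = s(tv t₁ t₂ t₃ a, tv t₁ t₂ t₃ b)

/-- The pair bit of a configuration: some edge of `S ∪ F` open in `x` joins the two terminals. -/
noncomputable def pairBit (G : E → Sym2 V) (S F : Finset E) (t₁ t₂ t₃ : V) (x : Config E)
    (a b : Fin 3) : Bool :=
  decide (∃ e ∈ S ∪ F, x e = true ∧ G e = s(tv t₁ t₂ t₃ a, tv t₁ t₂ t₃ b))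

/-- **The combined pattern** of a configuration: the three pair bits. -/
noncomputable def patX (G : E → Sym2 V) (S F : Finset E) (t₁ t₂ t₃ : V) (x : Config E) : Fin 8 :=
  patOf (pairBit G S F t₁ t₂ t₃ x 0 1) (pairBit G S F t₁ t₂ t₃ x 0 2) (pairBit G S F t₁ t₂ t₃ x 1 2)

/-- The pair bit is symmetric. -/
lemma pairBit_symm (G : E → Sym2 V) (S F : Finset E) (t₁ t₂ t₃ : V) (x : Config E) (a b : Fin 3) :
    pairBit G S F t₁ t₂ t₃ x a b = pairBit G S F t₁ t₂ t₃ x b a := by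
  unfold pairBit
  simp only [Sym2.eq_swap]

/-- The virtual edges of the combined pattern: `cfg (patX x) e₁ = pairBit 0 1`, etc. -/
lemma cfg_patX_1 (G : E → Sym2 V) (S F : Finset E) {e₁ e₂ e₃ : E} (t₁ t₂ t₃ : V) (x : Config E) :
    cfg e₁ e₂ e₃ (patX G S F t₁ t₂ t₃ x) e₁ = pairBit G S F t₁ t₂ t₃ x 0 1 := by
  rw [cfg_s0]
  unfold patX
  cases pairBit G S F t₁ t₂ t₃ x 0 1 <;> cases pairBit G S F t₁ t₂ t₃ x 0 2 <;>
    cases pairBit G S F t₁ t₂ t₃ x 1 2 <;> decide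

/-- The virtual edge `e₂` of the combined pattern carries the pair bit `0 2`. -/
lemma cfg_patX_2 (G : E → Sym2 V) (S F : Finset E) {e₁ e₂ e₃ : E} (h12 : e₁ ≠ e₂) (t₁ t₂ t₃ : V)
    (x : Config E) :
    cfg e₁ e₂ e₃ (patX G S F t₁ t₂ t₃ x) e₂ = pairBit G S F t₁ t₂ t₃ x 0 2 := by
  rw [cfg_s1 e₁ e₂ e₃ h12]
  unfold patX
  cases pairBit G S F t₁ t₂ t₃ x 0 1 <;> cases pairBit G S F t₁ t₂ t₃ x 0 2 <;>
    cases pairBit G S F t₁ t₂ t₃ x 1 2 <;> decide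

/-- The virtual edge `e₃` of the combined pattern carries the pair bit `1 2`. -/
lemma cfg_patX_3 (G : E → Sym2 V) (S F : Finset E) {e₁ e₂ e₃ : E} (h13 : e₁ ≠ e₃) (h23 : e₂ ≠ e₃)
    (t₁ t₂ t₃ : V) (x : Config E) :
    cfg e₁ e₂ e₃ (patX G S F t₁ t₂ t₃ x) e₃ = pairBit G S F t₁ t₂ t₃ x 1 2 := by
  rw [cfg_s2 e₁ e₂ e₃ h13 h23]
  unfold patX
  cases pairBit G S F t₁ t₂ t₃ x 0 1 <;> cases pairBit G S F t₁ t₂ t₃ x 0 2 <;>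
    cases pairBit G S F t₁ t₂ t₃ x 1 2 <;> decide

/-- The all-closed background of `x` on `S ∪ F`. -/
def bg (S F : Finset E) (x : Config E) : Config E := fun e => if e ∈ S ∪ F then false else x e

/-- The background lies below the configuration. -/
lemma bg_le (S F : Finset E) (x : Config E) : bg S F x ≤ x := by
  intro e; simp only [bg]; split_ifs
  · exact Bool.false_le _
  · exact le_rfl

/-- In the part graph an open virtual edge of the pattern `patX x` over the background is matched by an
open edge of `x` between the same terminals, and conversely. -/
theorem conn_terminal_edges_iff (ends : E → Sym2 V) (S F : Finset E) (hd : Disjoint F S) (t₁ t₂ t₃ : V)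
    (hF : TermEdges ends t₁ t₂ t₃ F) {e₁ e₂ e₃ : E} (h1 : e₁ ∈ S) (h2 : e₂ ∈ S) (h3 : e₃ ∈ S)
    (h12 : e₁ ≠ e₂) (h13 : e₁ ≠ e₃) (h23 : e₂ ≠ e₃) (x : Config E) (u v : V) :
    Conn (partEnds ends (↑S) e₁ e₂ e₃ t₁ t₂ t₃) x u v ↔
      Conn (partEnds ends (↑S) e₁ e₂ e₃ t₁ t₂ t₃)
        (setOn S (cfg e₁ e₂ e₃ (patX (partEnds ends (↑S) e₁ e₂ e₃ t₁ t₂ t₃) S F t₁ t₂ t₃ x)) (bg S F x))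
        u v := by
  set G' := partEnds ends (↑S) e₁ e₂ e₃ t₁ t₂ t₃ with hG'
  set y := setOn S (cfg e₁ e₂ e₃ (patX G' S F t₁ t₂ t₃ x)) (bg S F x) with hy
  -- an open edge of `x` between two terminals gives the virtual edge open in `y`
  have step_xy : ∀ a b : Fin 3, a ≠ b → pairBit G' S F t₁ t₂ t₃ x a b = true →
      Conn G' y (tv t₁ t₂ t₃ a) (tv t₁ t₂ t₃ b) := by
    intro a b hab hp
    refine conn_of_openAdj ⟨ve e₁ e₂ e₃ a b, ?_, partEnds_ve ends S h12 h13 h23 t₁ t₂ t₃ hab⟩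
    have hmem : ve e₁ e₂ e₃ a b ∈ S := by
      fin_cases a <;> fin_cases b <;> simp [ve] at hab ⊢ <;> assumption
    rw [hy, setOn_of_mem hmem]
    fin_cases a <;> fin_cases b <;> simp [ve] at hab ⊢
    · rw [cfg_patX_1 G' S F t₁ t₂ t₃ x]; exact hp
    · rw [cfg_patX_2 G' S F h12 t₁ t₂ t₃ x]; exact hp
    · rw [cfg_patX_1 G' S F t₁ t₂ t₃ x, pairBit_symm]; exact hp
    · rw [cfg_patX_3 G' S F h13 h23 t₁ t₂ t₃ x]; exact hp
    · rw [cfg_patX_2 G' S F h12 t₁ t₂ t₃ x, pairBit_symm]; exact hp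
    · rw [cfg_patX_3 G' S F h13 h23 t₁ t₂ t₃ x, pairBit_symm]; exact hp
  -- an open virtual edge of `y` is matched by an open edge of `x` between its terminals
  have step_yx : ∀ a b : Fin 3, a ≠ b → pairBit G' S F t₁ t₂ t₃ x a b = true →
      Conn G' x (tv t₁ t₂ t₃ a) (tv t₁ t₂ t₃ b) := by
    intro a b _ hp
    unfold pairBit at hp
    rw [decide_eq_true_eq] at hp
    obtain ⟨e, -, he, hends⟩ := hp
    exact conn_of_openAdj ⟨e, he, hends⟩
  constructor
  · intro h
    refine mem_of_conn_of_closed (ends := G') (ω := x) (S := {w | Conn G' y u w}) ?_ (conn_refl _ _ _) h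
    intro w hw w' hadj
    rw [openGraph_adj] at hadj
    obtain ⟨hne, e, he, hends⟩ := hadj
    simp only [Set.mem_setOf_eq] at hw ⊢
    by_cases heSF : e ∈ S ∪ F
    · -- an edge of `S ∪ F` joining `w`, `w'`: a virtual edge or a terminal edge; it joins two terminals
      have key : ∃ a b : Fin 3, a ≠ b ∧ G' e = s(tv t₁ t₂ t₃ a, tv t₁ t₂ t₃ b) := by
        rcases Finset.mem_union.1 heSF with heS | heF
        · by_cases k1 : e = e₁
          · exact ⟨0, 1, by decide, by rw [k1, hG', partEnds_apply_1]; rfl⟩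
          by_cases k2 : e = e₂
          · exact ⟨0, 2, by decide, by rw [k2, hG', partEnds_apply_2 ends (↑S) t₁ t₂ t₃ h12]; rfl⟩
          by_cases k3 : e = e₃
          · exact ⟨1, 2, by decide, by rw [k3, hG', partEnds_apply_3 ends (↑S) t₁ t₂ t₃ h13 h23]; rfl⟩
          · exfalso
            rw [hG', partEnds_apply_of_mem ends (↑S) t₁ t₂ t₃ k1 k2 k3 heS, Sym2.eq_iff] at hends
            rcases hends with ⟨rfl, rfl⟩ | ⟨rfl, rfl⟩ <;> exact hne rfl
        · obtain ⟨a, b, hab, hab'⟩ := hF e heF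
          have heS : e ∉ S := Finset.disjoint_left.mp hd heF
          exact ⟨a, b, hab, by rw [hG', partEnds_apply_of_notMem ends (↑S) t₁ t₂ t₃ h1 h2 h3 heS]; exact hab'⟩
      obtain ⟨a, b, hab, hGe⟩ := key
      have hp : pairBit G' S F t₁ t₂ t₃ x a b = true := by
        unfold pairBit; rw [decide_eq_true_eq]; exact ⟨e, heSF, he, hGe⟩
      have hc := step_xy a b hab hp
      rw [hGe, Sym2.eq_iff] at hends
      rcases hends with ⟨rfl, rfl⟩ | ⟨rfl, rfl⟩
      · exact conn_trans hw hc
      · exact conn_trans hw (conn_symm hc)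
    · -- a background edge, open in `y` too
      have hy' : y e = true := by
        rw [hy, setOn_of_not_mem (fun h => heSF (Finset.mem_union_left _ h))]
        simp only [bg, heSF, if_false]; exact he
      exact conn_trans hw (conn_of_openAdj ⟨e, hy', hends⟩)
  · intro h
    refine mem_of_conn_of_closed (ends := G') (ω := y) (S := {w | Conn G' x u w}) ?_ (conn_refl _ _ _) h
    intro w hw w' hadj
    rw [openGraph_adj] at hadj
    obtain ⟨hne, e, he, hends⟩ := hadj
    simp only [Set.mem_setOf_eq] at hw ⊢
    by_cases heS : e ∈ S
    · -- a virtual edge open in `y`: its pair bit is set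
      have hbit : ∃ a b : Fin 3, a ≠ b ∧ G' e = s(tv t₁ t₂ t₃ a, tv t₁ t₂ t₃ b) ∧
          pairBit G' S F t₁ t₂ t₃ x a b = true := by
        rw [hy, setOn_of_mem heS] at he
        by_cases k1 : e = e₁
        · subst k1; rw [cfg_patX_1 G' S F t₁ t₂ t₃ x] at he
          exact ⟨0, 1, by decide, by rw [hG', partEnds_apply_1]; rfl, he⟩
        by_cases k2 : e = e₂
        · subst k2; rw [cfg_patX_2 G' S F h12 t₁ t₂ t₃ x] at he
          exact ⟨0, 2, by decide, by rw [hG', partEnds_apply_2 ends (↑S) t₁ t₂ t₃ h12]; rfl, he⟩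
        by_cases k3 : e = e₃
        · subst k3; rw [cfg_patX_3 G' S F h13 h23 t₁ t₂ t₃ x] at he
          exact ⟨1, 2, by decide, by rw [hG', partEnds_apply_3 ends (↑S) t₁ t₂ t₃ h13 h23]; rfl, he⟩
        · exfalso
          have : cfg e₁ e₂ e₃ (patX G' S F t₁ t₂ t₃ x) e = false := cfg_other e₁ e₂ e₃ _ k1 k2 k3
          rw [this] at he; exact Bool.false_ne_true he
      obtain ⟨a, b, hab, hGe, hp⟩ := hbit
      have hc := step_yx a b hab hp
      rw [hGe, Sym2.eq_iff] at hends
      rcases hends with ⟨rfl, rfl⟩ | ⟨rfl, rfl⟩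
      · exact conn_trans hw hc
      · exact conn_trans hw (conn_symm hc)
    · -- a background edge (the terminal edges are closed in `y`)
      have hx' : x e = true := by
        rw [hy, setOn_of_not_mem heS] at he
        simp only [bg] at he
        by_cases hSF : e ∈ S ∪ F
        · rw [if_pos hSF] at he; exact absurd he Bool.false_ne_true
        · rw [if_neg hSF] at he; exact he
      exact conn_trans hw (conn_of_openAdj ⟨e, hx', hends⟩)

end TermEdges

end Part

end Summit.Ventures.PercRepro2
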